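import Literature.NumberTheory.EllipticCurves.BDPAnticyclotomicPAdicLFunction
import Literature.NumberTheory.EllipticCurves.CuspFormLFunction
import Literature.NumberTheory.EllipticCurves.HeegnerPoints
import Literature.NumberTheory.GaloisRepresentations.HeckeCharacterAutConj
import HarnessLib

/-!
# Shimura reciprocity for the normalized central values `L(f/K, χ, 1)/(π^{2n+1}·Ω^{4n})` over the Hilbert
# class field (Bertolini–Darmon–Prasanna 2013, Thm. 5.5 with its proof: (5.1.16), Prop. 1.12 (1), Lemma 5.3)

Trunk `Literature/NumberTheory/EllipticCurves`; companion of `BDPAnticyclotomicPAdicLFunction.lean` (Castella 2018,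
Thm. 3.1: `bdpInterpolationValue`, `rankinSelbergValueHecke`) and `AnticyclotomicRankinSelbergPAdicLFunction.lean`
(Hsieh 2014). ONE named fact (`def … : Prop`, nothing proved). Consumer: the K5-B binder of the `3 ∥ N` descent
of the cell `bsd-stepL` (`Summits/…/Theorems/ClassRecordThreeK5BOfArchimedeanReciprocity.lean`).

## The printed statements (author version of [BDP13], held as `paper:url-39cfb2a03b1d`; Duke Math. J. 162 (2013))

Setting (§4.1 pp. 34–37, §5.1 pp. 56–60): `f ∈ S_k(Γ₀(N), ε_f)` a normalised newform, `K` imaginary quadratic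
with the Heegner hypothesis «all the primes `q ∣ N` are either split or ramified in `K`, and if `q² ∣ N` then `q` is
split» (p. 36), a cyclic ideal `𝔑` of norm `N`, `c` prime to `N d_K`, «Suppose also that `c` and `d_K` are odd» (Thm.
4.6, p. 38; Assumption 5.12 (2)–(3)); `Σ_cc^{(2)}(𝔑)` = central critical characters `χ` of infinity type `(k+j, −j)`,
`j ≥ 0`, of finite type `(c, 𝔑, ε_f)` (Def. 4.4: `χ|_{Ô_c^×} = ψ_{ε_f}`; for `c = 1`, `ε_f = 1`: EVERYWHERE
UNRAMIFIED) with `ε_q(f, χ⁻¹) = +1`, «automatic except possibly at `q ∣ (N, d_K)`» (p. 37); `χ_j := χ·N^{−j}`;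
`L(f, χ, s) = L(π_f × π_χ, s − (k−1+ℓ₁+ℓ₂)/2)` with `π_f`, `π_χ` unitary (p. 34), so that for central critical `χ`
the point `s = 0` of `L(f, χ⁻¹, s)` is the unitary central point; Remark 4.3: «this `L`-value is unchanged if `χ` is
replaced by `χ̄`». CM datum (§1.4, §5.1 (5.1.1)): `(A₀, t₀, ω₀)`, `A₀ = ℂ/𝒪_c` with `Γ₁(N)`-structure `t₀` and a
regular differential `ω₀` over the ring class field `H_c`; (5.1.15) `ω₀ = Ω·2πi dw` defines the period `Ω ∈ ℂ^×`;
`H′_c ⊃ H_c` the field of the individual `𝔑`-torsion points, `Gal(H′_c/H_c) ⊂ (ℤ/Nℤ)^×`, `H̃_c ⊂ H′_c` the subfield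
fixed by `ker ε_f` (p. 60) — for `ε_f = 1`, `H̃_c = H_c`; (4.1.3) `f(L, a·t) = ε_f(a) f(L, t)` (p. 34).

* **Thm. 5.4 + (5.1.11), Lemma 5.3 (pp. 58–59).** `C(f,χ,c)·L(f,χ⁻¹,0) = w(f,χ)·(Σ_{[𝔞]∈Pic(𝒪_c)} χ_j⁻¹(𝔞)·
  Θ_k^j f(𝔞⋆(A₀,t,2πi dw)))²`, `w(f,χ) = w_f·ε_f(N𝔟)⁻¹·χ_j(𝔟)·(−N)^{k/2+j}·b_N^{−k−2j}` with «(3) for all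
  `σ ∈ Gal(L/K)`, `w(f,χ)^σ = w(f^σ, χ^σ)`», `C(f,χ,c) = ¼·π^{k+2j−1}Γ(j+1)Γ(k+j)·w_K·|d_K|^{1/2}·c·vol(𝒪_c)^{−(k+2j)}·
  2^{#S_f}·∏_{q∣c}(…)` (Thm. 4.6, p. 38).
* **Thm. 5.5 (p. 60).** «For all `χ ∈ Σ_cc^{(2)}(𝔑)` of infinity type `(k+j, −j)`, the quantity
  `L_alg(f,χ⁻¹,0) := w(f,χ)⁻¹C(f,χ,c)·L(f,χ⁻¹,0)/Ω^{2(k+2j)}` belongs to `F`» (`F` = the extension of `K` generated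
  by `H̃_c`, the values of `χ` and the Fourier coefficients of `f`), PROVED via «(5.1.16) `L_alg(f,χ⁻¹,0) =
  (Σ_{[𝔞]∈Pic(𝒪_c)} χ_j⁻¹(𝔞)·Θ^j_Hodge f(𝔞⋆(A₀,t₀,ω₀)))²` … Part 1 of Proposition 1.12 implies that the terms
  `Θ^j_Hodge f(𝔞⋆(A₀,t₀,ω₀))` belong to `F`».
* **Prop. 1.12 (1) (p. 14; Shimura).** For a marked CM curve `(A₀,t₀,ω₀)/F₁` and `f ∈ M_k(Γ, F₁)`: «the complex
  number `Θ_Hodge f(A₀,t₀,ω₀)` belongs to `ι_∞(F₁)`».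

## What is typed, and why it follows (`k = 2`, `ε_f = 1`, `c = 1`, `f` the rational newform of `E/ℚ`)

(D1) χ-DICTIONARY: a tree character `χ` of type `(n, −n)` (`HasInfinityType (n) (−n)`), `n ≥ 1`, everywhere
unramified, gives `χ_B := χ^{±1}·N_K ∈ Σ_cc^{(2)}(𝔑)` of type `(k+j, −j)` with `j = n − 1` (the sign chosen by Remark
4.3), finite type `(1, 𝔑, 1)`, and `2(k+2j) = 4n`; `S(f) = ∅` because every `q ∣ N` SPLITS (tree
`SatisfiesHeegnerHypothesis`), so the auxiliary sign condition is vacuous. (D2) `L`-DICTIONARY: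
`L(f, χ_B⁻¹, 0) = L(½, π_f × π_{χ⁻¹}) = L(f/K, χ, 1) = rankinSelbergValueHecke f χ 1` (p. 34 + Remark 4.3; the
tree's `rankinSelbergEulerProductHecke` docstring: «Castella–Hsieh's `L(s, π_K ⊗ χ)` up to the shift `s ↦ s − ½`»).
(D3) CM VALUES ARE χ-FREE AND LIE IN `H`: `V_{𝔞,j} := Θ^j_Hodge f(𝔞⋆(A₀,t₀,ω₀)) ∈ ι_∞(H′·K_f)` by Prop. 1.12 (1)
(`(A₀,t₀,ω₀)` is defined over `H′`), and is fixed by `Gal(H′/H) ⊂ (ℤ/Nℤ)^×` by (4.1.3) with `ε_f = 1` — this is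
the authors' `H̃_c`; for the rational newform `K_f = ℚ`, so `V_{𝔞,j} ∈ H := H_1`, the Hilbert class field.
(D4) EQUIVARIANCE: for `σ ∈ Aut(ℂ/H)`, `σ(χ_{B,j}⁻¹(𝔞)) = (^σχ)_{B,j}⁻¹(𝔞)` (Weil 1956: `^σχ` = the tree's
`HasInfinityType.autConj`, `(^σχ)(ϖ_v) = σ(χ(ϖ_v))`; `σ` fixes `K ⊂ H` so the type is kept and `^σχ_B ∈
Σ_cc^{(2)}(𝔑)`), hence by (5.1.16) applied to `χ_B` and to `^σχ_B`: `σ(L_alg(f,χ_B⁻¹,0)) = L_alg(f,(^σχ)_B⁻¹,0)`.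
(D5) CONSTANTS: `L_alg(f,χ_B⁻¹,0) = e(χ,n)·λ^n·(L(f/K,χ,1)/(π^{2n+1}Ω^{4n}))` with `λ` a constant depending on
`(K, c)` only (the `π`/`vol(𝒪_c)` monomial, an `n`-th power) and `e(χ,n) = ¼Γ(n)Γ(n+1)·w_K·|d_K|^{1/2}·2^{#S_f}·
w(f,χ_B)⁻¹`; by Lemma 5.3 (3) (`w_f = ±1` for the rational newform with `ε_f = 1`; `(−N)^{k/2+j} ∈ ℤ`; `b_N ∈ K`)
`σ(e(χ,n)) = e(^σχ,n)` for every `σ ∈ Aut(ℂ/K(i))` (`|d_K|^{1/2} = ∓ i·√d_K` with `√d_K ∈ K`). Absorbing `λ` into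
the period, `Ω′ := λ^{−1/4}·Ω`, gives EXACT reciprocity of `L(f/K,χ,1)/(π^{2n+1}Ω′^{4n})` under `Aut(ℂ/H(i))`.
(D6) THE FIELD `F := H(i) ⊂ ℂ` is finite over `ℚ`, contains `K`, and is unramified above every ODD rational prime
that is unramified in `K` (`H/K` is unramified — class field theory, Cox Thm. 8.10/§9.A; `ℚ(i)` ramifies only at
`2`) — in particular above every odd prime SPLIT in `K`. The typed statement ∃-quantifies `Ω′` and `F` with exactly
these properties (weaker than naming them), and restricts to the rational newform of an elliptic curve (`IsNewformOf
W f`, level = conductor, so `N ≥ 11` and BDP's `N > 4` holds), `K` imaginary quadratic of ODD discriminant with every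
`q ∣ N` split. NOT typed, NOT asserted: the (VR-A) cocycle for `σ ∈ Aut(ℂ/K)` moving `H` (assembled in no printed
source); anything at even `d_K` (BDP13 Remark 4.7: parity «for convenience»). This is a CONSEQUENCE of the printed
theorem assembled along (D1)–(D6); every step is located above.

## References
* [BDP13] M. Bertolini, H. Darmon, K. Prasanna, *Generalized Heegner cycles and p-adic Rankin L-series*, Duke Math.
  J. 162 (2013) 1033–1148: Prop. 1.12 (1) (p. 14), §4.1 (4.1.3), Remark 4.3, Def. 4.4, Thm. 4.6 (pp. 34–38), §5.1
  (5.1.11), Lemma 5.3, Thm. 5.4, (5.1.15), Thm. 5.5, (5.1.16) (pp. 56–60). [BertoliniDarmonPrasanna2013]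
* G. Shimura, *On some arithmetic properties of modular forms of one and several variables*, Ann. of Math. 102
  (1975) (= [Shim1] of BDP13). [Shimura1975]
* A. Weil, *On a certain type of characters of the idèle-class group of an algebraic number-field* (1956), §1.
  [Weil1956]
* F. Castella, M.-L. Hsieh, Math. Ann. 370 (2018), §2.5 (the period convention `Ω_K·2πi dw = ω_A`), §3.3.
  [CastellaHsieh2018]
-/

noncomputable section

open scoped NumberField
open NumberField IsDedekindDomain
open Literature.NumberTheory.GaloisRepresentations
open Literature.NumberTheory.EllipticCurves.ModularForms

namespace Literature.NumberTheory.EllipticCurves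

/-- **Bertolini–Darmon–Prasanna 2013, Thm. 5.5 (with its proof (5.1.16), Prop. 1.12 (1) = Shimura, Lemma 5.3 (3)):
`Aut(ℂ/H(i))`-reciprocity of the normalized central values `L(f/K, χ, 1)/(π^{2n+1}·Ω^{4n})`.** For the newform `f`
of level `N = N_W` of an elliptic curve `W/ℚ` and an imaginary quadratic `K` of ODD discriminant in which every prime
dividing `N` splits, there are a period `Ω ≠ 0` (BDP13 (5.1.15) rescaled by a constant, module docstring (D5)) and a
subfield `F ⊂ ℂ` finite over `ℚ` (the Hilbert class field of `K` with `i` adjoined, (D6)) containing `K` and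
unramified above every odd rational prime split in `K`, such that for every `σ ∈ Aut(ℂ)` fixing `F` pointwise and
every everywhere-unramified Hecke character `χ` of `K` of infinity type `(n, −n)`, `n ≥ 1`:
`σ(L(f/K,χ,1)/(π^{2n+1}Ω^{4n})) = L(f/K,^σχ,1)/(π^{2n+1}Ω^{4n})`, where `^σχ = HasInfinityType.autConj` (Weil) and
`L(f/K,χ,1) = rankinSelbergValueHecke f χ 1`. Printed: «`L_alg(f,χ⁻¹,0)` belongs to `F`» (Thm. 5.5), proved as
`L_alg = (Σ_{[𝔞]} χ_j⁻¹(𝔞)·Θ^j_Hodge f(𝔞⋆(A₀,t₀,ω₀)))²` (5.1.16) with the `χ`-free CM values in the Hilbert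
class field (Prop. 1.12 (1) + (4.1.3)); typed as the resulting `σ`-equivariance along the dictionary (D1)–(D6) of
the module docstring. A `Prop`, NOT asserted (named fact). -- TODO(general form): `f` of weight `k` with
nebentypus, conductor `c > 1`, and the `Aut(ℂ/K)`-cocycle.
[cite: BertoliniDarmonPrasanna2013, Thm. 5.5 and (5.1.16) (p. 60); Prop. 1.12 (1) (p. 14); Lemma 5.3 (p. 58)] -/
def bertoliniDarmonPrasanna2013_centralValue_reciprocity : Prop :=
  ∀ (W : WeierstrassCurve ℚ) [W.IsElliptic] (K : Type) [Field K] [NumberField K] {N : ℕ} [NeZero N]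
    (f : CuspForm (CongruenceSubgroup.Gamma0 N) 2),
    IsNewformOf W f → W.conductorNorm ℤ = N → IsImaginaryQuadratic K → Odd (NumberField.discr K) →
    SatisfiesHeegnerHypothesis N K →
    ∃ (Ω : ℂ) (F : IntermediateField ℚ ℂ), Ω ≠ 0 ∧ FiniteDimensional ℚ F ∧
      (∀ (φ : K →+* ℂ) (k : K), φ k ∈ F) ∧
      (∀ ℓ : ℕ, ℓ.Prime → ℓ ≠ 2 → ((Ideal.span {(ℓ : ℤ)}).primesOver (𝓞 K)).ncard = 2 →
        ∀ P : Ideal (𝓞 F), P.IsPrime → ((ℓ : ℕ) : 𝓞 F) ∈ P → P.ramificationIdx (𝓞 ℚ) = 1) ∧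
      ∀ σ : ℂ ≃ₐ[ℚ] ℂ, (∀ x : ℂ, x ∈ F → σ x = x) →
        ∀ (χ : HeckeCharacter K) (n : ℕ), 0 < n →
          (∀ v : HeightOneSpectrum (𝓞 K), χ.IsUnramifiedAt v) →
          ∀ hχ : χ.HasInfinityType (fun _ ↦ (n : ℤ)) (fun _ ↦ -(n : ℤ)),
            σ (rankinSelbergValueHecke f χ 1 / ((Real.pi : ℂ) ^ (2 * n + 1) * Ω ^ (4 * n))) =
              rankinSelbergValueHecke f (hχ.autConj σ) 1 / ((Real.pi : ℂ) ^ (2 * n + 1) * Ω ^ (4 * n))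

end Literature.NumberTheory.EllipticCurves

end
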